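import Mathlib

/-!
# The ratio knapsack `E(n) = U_{p,k} ⊕ B_{⌊√n⌋}(𝔫_d)` — U-BLOCK LEVEL-FUNCTION LEMMAS (U1)/(U2): a good loop or 2-cycle forces
# `(p−2)·c ≤ r`, a single good edge forces `(p−2)·c ≤ p·r` (Negative lane of crux `DualUnipotentThreeHalves`, supports stmt-ValiantsHypothesis-24318)

val-port-2 g3 (24318 line α `krylov_seed` LEAD; the line is DEAD ON PAPER — director-valiant R302/R304; this is hand (ii)(b) of R304: the pure
combinatorics of annex §4 of val-idea-crit-7 g2's `Cruxes/DualUnipotentThreeHalves/CRITIC-V19-UniformWeightLaw-dead.md` @a92a18731268, first leg val-idea-30 g3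
`Ideas/ratio-knapsack.md` §(2)).  SETTING (what a COORDINATE weight certificate `(lvl, r, c)` of a pencil containing `U_{p,k} = {J_p⊗A + βR_p⊗1}` must
satisfy on the levels `L s a := lvl(e_s ⊗ e_a)`, slots `s = 0..p−1`, vertices `a`): the constant letters `J_p ⊗ E_{ab}` force the SLOT DROP
(J) `L (s+1) b ≤ L s a + r` for all `a, b` and `s+1 < p`; the returns `R_p ⊗ 1 = (E_{p−2,0} − E_{p−1,1}) ⊗ 1` force (R) `L 0 a ≤ L (p−2) a + r` (and
`L 1 a ≤ L (p−1) a + r`); a top coordinate `A_{ab}` is GOOD (admissible in `K`) iff it CLIMBS at every slot: `L (s+1) b + c ≤ L s a` for all `s+1 < p`.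
Here the level function is abstract (`L : ℕ → α → ℤ`, any vertex type `α`), the hypotheses are stated inline (no definitions), and we prove:

* `loop_forces_ratio` — (U1) a good LOOP `(a,a)` with (R) at `a` forces `(p−2)·c ≤ r` (telescoping down the slots);
* `twoCycle_forces_ratio` — (U1) for EVEN `p`, a good 2-CYCLE `(a,b),(b,a)` with (R) at `a` forces `(p−2)·c ≤ r` (alternate `a, b, a, …`);
* `edge_forces_ratio` — (U2) for EVEN `p`, ONE good edge `(a,b)` with (J) and (R) at `a` forces `(p−2)·c ≤ p·r` (climb with the good edge at even
  slots, fall back with (J) at odd slots: `L 0 a ≥ L (p−2) a + ((p−2)/2)(c − r)`).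
Read with `ρ = r/c`: for `ρ < p−2` the good graph has no loops and no 2-cycles, for `ρ < (p−2)/p` it is EMPTY — the two thresholds of annex §4 that make the
U-block overdraw every certificate budget below ratio `p − 2`.

Honest framing: elementary inequalities about integer level functions; nothing here is a `¬`-theorem yet (the kernel kill of C⁺ `UniformWeightLaw` needs the
torus reduction §3, PAPER, as an explicit hypothesis H — director R302 (2)), nothing touches R2 `HeavyTopLaw` / 24318 / 8062, and `VP ≠ VNP` is NOT proved.
No definitions, no named facts. [val-idea-30 g3 §(2); crit-7 g2 V19 annex §4 (U1)/(U2)]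
-/

-- single-conjunct layout: Sub = Summit, duplicated namespace component intended (the name is mandated)
set_option linter.dupNamespace false
set_option autoImplicit false

namespace Summit.ValiantsHypothesis.ValiantsHypothesis.Theorems.DualUnipotentThreeHalvesNegative.RatioKnapsackUBlock

variable {α : Type*}

/-- **(U1), loop.**  If the loop `(a,a)` is good (`L (s+1) a + c ≤ L s a` at every slot step) and the return constraint `L 0 a ≤ L (p−2) a + r`
holds, then `(p−2)·c ≤ r`. [crit-7 g2 V19 annex §4 (U1); val-idea-30 g3] -/
theorem loop_forces_ratio (p : ℕ) (hp : 2 ≤ p) (r c : ℤ) (L : ℕ → α → ℤ) (a : α)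
    (hgood : ∀ s, s + 1 < p → L (s + 1) a + c ≤ L s a) (hR : L 0 a ≤ L (p - 2) a + r) :
    ((p - 2 : ℕ) : ℤ) * c ≤ r := by
  have h : ∀ j, j ≤ p - 2 → L j a + (j : ℤ) * c ≤ L 0 a := by
    intro j
    induction j with
    | zero => intro _; simp
    | succ j ih =>
        intro hj
        have h1 := ih (by omega)
        have h2 := hgood j (by omega)
        push_cast
        linarith
  have := h (p - 2) le_rfl
  linarith

/-- **(U1), 2-cycle** (`p` even).  If both `(a,b)` and `(b,a)` are good and the return constraint holds at `a`, then `(p−2)·c ≤ r`: alternate along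
`a, b, a, …`; after the EVEN number `p − 2` of slot steps one is back at `a`. [crit-7 g2 V19 annex §4 (U1); val-idea-30 g3] -/
theorem twoCycle_forces_ratio (p : ℕ) (hp : 2 ≤ p) (heven : Even p) (r c : ℤ) (L : ℕ → α → ℤ) (a b : α)
    (hab : ∀ s, s + 1 < p → L (s + 1) b + c ≤ L s a) (hba : ∀ s, s + 1 < p → L (s + 1) a + c ≤ L s b)
    (hR : L 0 a ≤ L (p - 2) a + r) :
    ((p - 2 : ℕ) : ℤ) * c ≤ r := by
  -- after `2j` steps we are at `a`, after `2j+1` steps at `b`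
  have h : ∀ j, 2 * j ≤ p - 2 → L (2 * j) a + (2 * j : ℤ) * c ≤ L 0 a := by
    intro j
    induction j with
    | zero => intro _; simp
    | succ j ih =>
        intro hj
        have h1 := ih (by omega)
        have h2 := hab (2 * j) (by omega)
        have h3 := hba (2 * j + 1) (by omega)
        have e : 2 * (j + 1) = 2 * j + 1 + 1 := by ring
        rw [e]
        push_cast
        linarith
  obtain ⟨q, hq⟩ := heven
  have hq1 : 2 * (q - 1) = p - 2 := by omega
  have := h (q - 1) (by omega)
  rw [hq1] at this
  have e : (2 * ((q - 1 : ℕ) : ℤ)) = ((p - 2 : ℕ) : ℤ) := by omega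
  rw [e] at this
  linarith

/-- **(U2), single edge** (`p` even).  ONE good edge `(a,b)`, the slot-drop constraint (J) `L (s+1) y ≤ L s x + r` (all `x, y`) and the return constraint
at `a` force `(p−2)·c ≤ p·r`, i.e. `ρ ≥ (p−2)/p`: climb `≥ c` with the good edge at even slots, drop `≤ r` back to `a` at odd slots, so
`L (p−2) a + ((p−2)/2)(c − r) ≤ L 0 a ≤ L (p−2) a + r`. [crit-7 g2 V19 annex §4 (U2); val-idea-30 g3] -/
theorem edge_forces_ratio (p : ℕ) (hp : 2 ≤ p) (heven : Even p) (r c : ℤ) (L : ℕ → α → ℤ) (a b : α)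
    (hab : ∀ s, s + 1 < p → L (s + 1) b + c ≤ L s a) (hJ : ∀ s, s + 1 < p → ∀ x y : α, L (s + 1) y ≤ L s x + r)
    (hR : L 0 a ≤ L (p - 2) a + r) :
    ((p - 2 : ℕ) : ℤ) * c ≤ (p : ℤ) * r := by
  have h : ∀ j, 2 * j ≤ p - 2 → L (2 * j) a + (j : ℤ) * (c - r) ≤ L 0 a := by
    intro j
    induction j with
    | zero => intro _; simp
    | succ j ih =>
        intro hj
        have h1 := ih (by omega)
        have h2 := hab (2 * j) (by omega)
        have h3 := hJ (2 * j + 1) (by omega) b a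
        have e : 2 * (j + 1) = 2 * j + 1 + 1 := by ring
        rw [e]
        push_cast
        linarith
  obtain ⟨q, hq⟩ := heven
  have hq1 : 2 * (q - 1) = p - 2 := by omega
  have := h (q - 1) (by omega)
  rw [hq1] at this
  have key : ((q - 1 : ℕ) : ℤ) * (c - r) ≤ r := by linarith
  have hq1' : ((q - 1 : ℕ) : ℤ) = (q : ℤ) - 1 := by omega
  have hp' : (p : ℤ) = 2 * (q : ℤ) := by omega
  have hp2 : ((p - 2 : ℕ) : ℤ) = 2 * (q : ℤ) - 2 := by omega
  rw [hq1'] at key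
  rw [hp2, hp']
  nlinarith [key]

end Summit.ValiantsHypothesis.ValiantsHypothesis.Theorems.DualUnipotentThreeHalvesNegative.RatioKnapsackUBlock
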